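import Literature.NumberTheory.LFunctions.ZeroDensityInghamHuxley
import Literature.NumberTheory.LFunctions.WeilZeroSum
import HarnessLib

/-!
# Persistence programme, M2 even sector — `(SUM_θ)` from the zero-density facts of the tree
(pub-rhpf cell, M2 seat, gen 7, part 7c)

Long-odds MECHANISM SEARCH; **no RH claims**.  RH-free, kernel-checked, and INDEPENDENT of the
cosine product (parts 7a–7b): this file only concerns the summability
`(SUM_θ)  ∑_{ρ ∈ 𝒵_θ} 1/Im ρ < ∞` over the quadrants
`𝒵_θ = {ρ non-trivial zero : Re ρ ≥ 1/2 + θ, Im ρ > 0}` (`θ > 0`), which part 7d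
(`…SummableMultiplier.lean`) turns into the multiplier statement `(MULT_θ)` and the closing of the
even negative-index ladder.

* `summable_inv_im_of_dyadic`, `summable_inv_im_of_countingPowerBound` (PROVED, elementary): for a
  set `Z` in the upper half-plane, a power-saving count `#{ρ ∈ Z : Im ρ ≤ T} ≤ C·T^c` (`T ≥ 1`,
  `c < 1`) gives `∑_Z 1/Im ρ < ∞` (dyadic blocks + geometric series).
* `QuadrantCountingPowerBound θ` (typed SHAPE, `@[conjecture] def`): that count for `𝒵_θ`;
  `summable_inv_im_quadrant_of_counting` (PROVED): shape ⇒ `(SUM_θ)`.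
* `quadrant_finite_and_ncard_le` (PROVED): `#{ρ ∈ 𝒵_θ : Im ρ ≤ T} ≤ N(σ, T)` for `σ ≤ 1/2 + θ`,
  where `N(σ, T) = zetaZeroCountRe σ T` is the tree's counting function (zeros `Re ρ ≥ σ`,
  `0 < Im ρ ≤ T`, with multiplicity; `Literature/NumberTheory/LFunctions/ZetaZeros.lean`).
* `quadrantCountingPowerBound_of_zeroDensityEstimate(_half)` (PROVED): the tree's rh.S12 interface
  `ZeroDensityEstimate A σ₀` (`N(σ,T) = O_{ε,σ}(T^{A(σ)(1−σ)+ε})` on `[σ₀, 1]`,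
  `Literature/NumberTheory/LFunctions/ZeroCounting.lean`) at ONE abscissa `σ ≤ 1/2 + θ` with
  `A(σ)(1−σ) < 1` gives the shape (the `O` is made uniform on `T ≥ 1` by monotonicity in `T`).
* `quadrantCountingPowerBound_of_ingham`, `summable_inv_im_quadrant_of_ingham` (PROVED modulo the
  NAMED FACT): the tree's vendored named fact `Literature.NumberTheory.LFunctions.zeroDensity_ingham`
  (Ingham 1940: `N(σ,T) ≪ T^{3(1−σ)/(2−σ)+ε}` on `[1/2, 1]`; Titchmarsh, *The theory of the Riemann
  zeta-function*, 2nd ed., p. 173 Thm 9.19 (B); CITED — used only as the hypothesis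
  `(h : zeroDensity_ingham)` as the Literature model prescribes; `3(1−σ)/(2−σ) < 1 ⟺ σ > 1/2`)
  gives the shape and `(SUM_θ)` for EVERY `θ > 0`.  For comparison,
  `quadrantCountingPowerBound_of_densityHypothesis` (the density hypothesis, `A ≡ 2`, an OPEN
  CONJECTURE in the tree — not needed).  The uniform exponents `12/5` (Huxley) and `30/13`
  (Guth–Maynard) of the same interface do NOT suffice near the line (`(12/5)(1−σ) < 1 ⟺ σ > 7/12`).

Labels: PROVED = kernel-checked here; CITED = the pre-existing named fact `zeroDensity_ingham`
(nothing is minted here; ABSOLUTE RULE respected); the classical sources for the shape itself are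
Carlson 1920 (Titchmarsh p. 170 Thm 9.17, `4σ(1−σ)`), Ingham (pp. 172–173 Thm 9.19 (A), (B)) and
Selberg (p. 173 Thm 9.19 (C)).
-/

noncomputable section
set_option linter.dupNamespace false

open Complex Filter Set Asymptotics
open scoped Real Topology

namespace Summit.RiemannHypothesis.RiemannHypothesis.Theorems.PfPersistenceM2NegIndex

open Literature.NumberTheory.LFunctions
open Literature.NumberTheory.LFunctions.ZetaZeros

/-! ## 1. Power-saving count ⇒ summability (dyadic partial summation) -/

/-- **Dyadic partial summation (PROVED, RH-free).**  If a set `Z` in the upper half-plane has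
`#{ρ ∈ Z : Im ρ ≤ 2^j} ≤ C a^j` for every `j` with some `a < 2`, then `∑_{ρ ∈ Z} 1/Im ρ < ∞`
(`≤ ∑_{Im ρ ≤ 1} 1/Im ρ + C + C/(1 - a/2)` over every finite subfamily). [folklore] -/
theorem summable_inv_im_of_dyadic {Z : Set ℂ} (hZ : ∀ ρ ∈ Z, 0 < ρ.im) {a C : ℝ} (ha0 : 0 ≤ a)
    (ha : a < 2) (hN : ∀ j : ℕ, {ρ ∈ Z | ρ.im ≤ 2 ^ j}.Finite ∧
      (({ρ ∈ Z | ρ.im ≤ 2 ^ j}.ncard : ℕ) : ℝ) ≤ C * a ^ j) :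
    Summable fun ρ : ↥Z ↦ 1 / (ρ : ℂ).im := by
  have hf0 : ∀ ρ : ↥Z, 0 ≤ 1 / (ρ : ℂ).im := fun ρ ↦ (one_div_pos.mpr (hZ ρ ρ.2)).le
  have hC : 0 ≤ C := by
    have h := (hN 0).2
    simp only [pow_zero, mul_one] at h
    exact (Nat.cast_nonneg _).trans h
  set r : ℝ := a / 2 with hr
  have hr0 : 0 ≤ r := by positivity
  have hr1 : r < 1 := by rw [hr, div_lt_one (by norm_num : (0:ℝ) < 2)]; exact ha
  have hrpow : ∀ j : ℕ, a ^ j * ((2:ℝ) ^ j)⁻¹ = r ^ j := fun j ↦ by rw [hr, div_pow, div_eq_mul_inv]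
  obtain ⟨hfin0, -⟩ := hN 0
  -- the count bound transported to finite subfamilies of `↥Z`
  have hcount : ∀ (F : Finset ↥Z) (j : ℕ),
      ((F.filter fun ρ : ↥Z ↦ (ρ : ℂ).im ≤ 2 ^ j).card : ℝ) ≤ C * a ^ j := by
    intro F j
    refine le_trans ?_ (hN j).2
    rw [Nat.cast_le, Set.ncard_eq_toFinset_card _ (hN j).1]
    refine Finset.card_le_card_of_injOn Subtype.val (fun ρ hρ ↦ ?_)
      (Set.injOn_of_injective Subtype.val_injective)
    rw [Finset.coe_filter] at hρ
    simp only [Set.Finite.coe_toFinset, Set.mem_setOf_eq]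
    exact ⟨ρ.2, hρ.2⟩
  -- the dyadic pointwise inequality, by induction on the top scale
  have dy : ∀ (J : ℕ) (x : ℝ), 1 ≤ x → x ≤ 2 ^ J → 1 / x ≤ ((2:ℝ) ^ J)⁻¹ +
      ∑ j ∈ Finset.range J, (if x ≤ 2 ^ (j + 1) then ((2:ℝ) ^ (j + 1))⁻¹ else 0) := by
    intro J
    induction J with
    | zero =>
      intro x h1 h2
      rw [pow_zero] at h2
      obtain rfl : x = 1 := le_antisymm h2 h1
      simp
    | succ J ih =>
      intro x h1 h2
      rw [Finset.sum_range_succ, if_pos h2]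
      have e : ((2:ℝ) ^ J)⁻¹ = ((2:ℝ) ^ (J + 1))⁻¹ + ((2:ℝ) ^ (J + 1))⁻¹ := by
        rw [pow_succ]; field_simp; norm_num
      by_cases hx : x ≤ 2 ^ J
      · have := ih x h1 hx
        linarith
      · rw [not_le] at hx
        have h3 : 1 / x ≤ ((2:ℝ) ^ J)⁻¹ := by
          rw [one_div]; exact inv_anti₀ (by positivity) hx.le
        have hS : 0 ≤ ∑ j ∈ Finset.range J,
            (if x ≤ 2 ^ (j + 1) then ((2:ℝ) ^ (j + 1))⁻¹ else 0) :=
          Finset.sum_nonneg fun j _ ↦ by split_ifs <;> positivity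
        linarith
  refine summable_of_sum_le hf0
    (c := (∑ z ∈ hfin0.toFinset, 1 / z.im) + (C + C * (1 - r)⁻¹)) fun F ↦ ?_
  -- a top scale for `F`
  obtain ⟨J, hJ⟩ : ∃ J : ℕ, ∀ ρ ∈ F, (ρ : ℂ).im ≤ 2 ^ J := by
    obtain ⟨J, hJ⟩ := pow_unbounded_of_one_lt (∑ ρ ∈ F, (ρ : ℂ).im) (by norm_num : (1:ℝ) < 2)
    exact ⟨J, fun ρ hρ ↦
      ((Finset.single_le_sum (fun (ρ' : ↥Z) _ ↦ (hZ _ ρ'.property).le) hρ).trans hJ.le)⟩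
  -- pointwise splitting of each term
  have pt : ∀ ρ ∈ F, 1 / (ρ : ℂ).im ≤ (if (ρ : ℂ).im < 1 then 1 / (ρ : ℂ).im else 0) +
      (((2:ℝ) ^ J)⁻¹ + ∑ j ∈ Finset.range J,
        (if (ρ : ℂ).im ≤ 2 ^ (j + 1) then ((2:ℝ) ^ (j + 1))⁻¹ else 0)) := by
    intro ρ hρ
    by_cases h1 : (ρ : ℂ).im < 1
    · rw [if_pos h1]
      have : 0 ≤ ((2:ℝ) ^ J)⁻¹ + ∑ j ∈ Finset.range J,
          (if (ρ : ℂ).im ≤ 2 ^ (j + 1) then ((2:ℝ) ^ (j + 1))⁻¹ else 0) :=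
        add_nonneg (by positivity) (Finset.sum_nonneg fun j _ ↦ by split_ifs <;> positivity)
      linarith
    · rw [if_neg h1, zero_add]
      exact dy J _ (not_lt.mp h1) (hJ ρ hρ)
  -- the three pieces
  have h_small : ∑ ρ ∈ F, (if (ρ : ℂ).im < 1 then 1 / (ρ : ℂ).im else 0)
      ≤ ∑ z ∈ hfin0.toFinset, 1 / z.im := by
    have e : ∑ ρ ∈ F.filter (fun ρ : ↥Z ↦ (ρ : ℂ).im < 1), 1 / (ρ : ℂ).im =
        ∑ z ∈ (F.filter fun ρ : ↥Z ↦ (ρ : ℂ).im < 1).map (Function.Embedding.subtype _),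
          1 / z.im := by
      simp only [Finset.sum_map, Function.Embedding.coe_subtype]
    rw [← Finset.sum_filter, e]
    refine Finset.sum_le_sum_of_subset_of_nonneg (fun z hz ↦ ?_) fun z hz _ ↦ ?_
    · rw [Finset.mem_map] at hz
      obtain ⟨ρ, hρ, rfl⟩ := hz
      rw [Finset.mem_filter] at hρ
      simp only [Set.Finite.mem_toFinset, Set.mem_setOf_eq, pow_zero, Function.Embedding.coe_subtype]
      exact ⟨ρ.2, hρ.2.le⟩
    · simp only [Set.Finite.mem_toFinset, Set.mem_setOf_eq] at hz
      exact (one_div_pos.mpr (hZ z hz.1)).le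
  have h_top : (F.card : ℝ) * ((2:ℝ) ^ J)⁻¹ ≤ C := by
    have h := hcount F J
    rw [Finset.filter_true_of_mem hJ] at h
    calc (F.card : ℝ) * ((2:ℝ) ^ J)⁻¹ ≤ C * a ^ J * ((2:ℝ) ^ J)⁻¹ :=
          mul_le_mul_of_nonneg_right h (by positivity)
      _ = C * r ^ J := by rw [mul_assoc, hrpow]
      _ ≤ C * 1 := mul_le_mul_of_nonneg_left (pow_le_one₀ hr0 hr1.le) hC
      _ = C := mul_one C
  have h_bands : ∑ j ∈ Finset.range J, ∑ ρ ∈ F,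
      (if (ρ : ℂ).im ≤ 2 ^ (j + 1) then ((2:ℝ) ^ (j + 1))⁻¹ else 0) ≤ C * (1 - r)⁻¹ := by
    have step : ∀ j ∈ Finset.range J, ∑ ρ ∈ F,
        (if (ρ : ℂ).im ≤ 2 ^ (j + 1) then ((2:ℝ) ^ (j + 1))⁻¹ else 0) ≤ C * r ^ j := by
      intro j _
      rw [← Finset.sum_filter, Finset.sum_const, nsmul_eq_mul]
      calc ((F.filter fun ρ : ↥Z ↦ (ρ : ℂ).im ≤ 2 ^ (j + 1)).card : ℝ) * ((2:ℝ) ^ (j + 1))⁻¹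
          ≤ C * a ^ (j + 1) * ((2:ℝ) ^ (j + 1))⁻¹ :=
            mul_le_mul_of_nonneg_right (hcount F (j + 1)) (by positivity)
        _ = C * r ^ (j + 1) := by rw [mul_assoc, hrpow]
        _ ≤ C * r ^ j :=
            mul_le_mul_of_nonneg_left (pow_le_pow_of_le_one hr0 hr1.le (Nat.le_succ j)) hC
    refine (Finset.sum_le_sum step).trans ?_
    rw [← Finset.mul_sum, ← tsum_geometric_of_lt_one hr0 hr1]
    exact mul_le_mul_of_nonneg_left
      ((summable_geometric_of_lt_one hr0 hr1).sum_le_tsum _ fun j _ ↦ pow_nonneg hr0 j) hC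
  calc ∑ ρ ∈ F, 1 / (ρ : ℂ).im
      ≤ ∑ ρ ∈ F, ((if (ρ : ℂ).im < 1 then 1 / (ρ : ℂ).im else 0) +
          (((2:ℝ) ^ J)⁻¹ + ∑ j ∈ Finset.range J,
            (if (ρ : ℂ).im ≤ 2 ^ (j + 1) then ((2:ℝ) ^ (j + 1))⁻¹ else 0))) :=
        Finset.sum_le_sum pt
    _ = ∑ ρ ∈ F, (if (ρ : ℂ).im < 1 then 1 / (ρ : ℂ).im else 0) +
          ((F.card : ℝ) * ((2:ℝ) ^ J)⁻¹ + ∑ j ∈ Finset.range J, ∑ ρ ∈ F,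
            (if (ρ : ℂ).im ≤ 2 ^ (j + 1) then ((2:ℝ) ^ (j + 1))⁻¹ else 0)) := by
        rw [Finset.sum_add_distrib, Finset.sum_add_distrib, Finset.sum_const, nsmul_eq_mul,
          Finset.sum_comm]
    _ ≤ _ := add_le_add h_small (add_le_add h_top h_bands)

/-- **Power-saving counting bound ⇒ summability (PROVED, RH-free).**  If
`#{ρ ∈ Z : Im ρ ≤ T} ≤ C T^c` for all `T ≥ 1` with `c < 1`, then `∑_{ρ ∈ Z} 1/Im ρ < ∞`.
[folklore] -/
theorem summable_inv_im_of_countingPowerBound {Z : Set ℂ} (hZ : ∀ ρ ∈ Z, 0 < ρ.im) {c C : ℝ}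
    (hc : c < 1) (hN : ∀ T : ℝ, 1 ≤ T → {ρ ∈ Z | ρ.im ≤ T}.Finite ∧
      (({ρ ∈ Z | ρ.im ≤ T}.ncard : ℕ) : ℝ) ≤ C * T ^ c) :
    Summable fun ρ : ↥Z ↦ 1 / (ρ : ℂ).im := by
  refine summable_inv_im_of_dyadic hZ (a := (2:ℝ) ^ c) (C := C) (by positivity) ?_ fun j ↦ ?_
  · calc (2:ℝ) ^ c < (2:ℝ) ^ (1:ℝ) := Real.rpow_lt_rpow_of_exponent_lt (by norm_num) hc
      _ = 2 := Real.rpow_one 2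
  · obtain ⟨hfin, hle⟩ := hN (2 ^ j) (one_le_pow₀ (by norm_num))
    refine ⟨hfin, hle.trans_eq ?_⟩
    congr 1
    rw [← Real.rpow_natCast 2 j, ← Real.rpow_mul (by norm_num : (0:ℝ) ≤ 2), mul_comm (j : ℝ) c,
      Real.rpow_mul_natCast (by norm_num : (0:ℝ) ≤ 2)]

/-- **HYPOTHESIS (density shape), typed.**  A power-saving bound for the zero count of the
quadrant `𝒵_θ`: `#{ρ ∈ 𝒵_θ : Im ρ ≤ T} ≤ C T^c` for all `T ≥ 1`, some `c < 1`.  This is the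
shape of the classical zero-density theorem (Carlson 1920, `N(σ, T) = O(T^{4σ(1-σ)+ε})` for
fixed `1/2 < σ < 1`; Titchmarsh, *The theory of the Riemann zeta-function*, 2nd ed., p. 170
Thm 9.17, pp. 172–173 Thm 9.19 (A)–(C); take `σ = 1/2 + θ/2`, absorb the logarithm into `T^ε`);
it is NOT formalised in the tree and is used below ONLY as an explicit hypothesis — a binder,
never a minted fact (`@[conjecture]` = open obligation node of the tree: the classical proof is
not kernel-checked here). -/
@[conjecture] def QuadrantCountingPowerBound (θ : ℝ) : Prop :=
  ∃ c : ℝ, c < 1 ∧ ∃ C : ℝ, ∀ T : ℝ, 1 ≤ T →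
    {ρ ∈ {ρ : ℂ | ρ ∈ riemannZetaNontrivialZeros ∧ 1 / 2 + θ ≤ ρ.re ∧ 0 < ρ.im} | ρ.im ≤ T}.Finite ∧
    (({ρ ∈ {ρ : ℂ | ρ ∈ riemannZetaNontrivialZeros ∧ 1 / 2 + θ ≤ ρ.re ∧ 0 < ρ.im} |
        ρ.im ≤ T}.ncard : ℕ) : ℝ) ≤ C * T ^ c

/-- **Density shape ⇒ `(SUM_θ)` (PROVED, RH-free).** [folklore] -/
theorem summable_inv_im_quadrant_of_counting {θ : ℝ} (h : QuadrantCountingPowerBound θ) :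
    Summable fun ρ : ↥{ρ : ℂ | ρ ∈ riemannZetaNontrivialZeros ∧ 1 / 2 + θ ≤ ρ.re ∧ 0 < ρ.im} ↦
      1 / (ρ : ℂ).im := by
  obtain ⟨c, hc, C, hN⟩ := h
  exact summable_inv_im_of_countingPowerBound (fun ρ hρ ↦ hρ.2.2) hc hN

/-! ## 2. The quadrant count is dominated by `N(σ, T)` -/

/-- **Quadrant count ≤ `N(σ, T)` (PROVED, RH-free).**  For `σ ≤ 1/2 + θ` the zeros of the quadrant
`𝒵_θ = {ρ : Re ρ ≥ 1/2 + θ, Im ρ > 0}` with `Im ρ ≤ T` form a finite set of cardinality at most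
`N(σ, T) = zetaZeroCountRe σ T` (they lie in the counting box `zetaZeroBox σ T`, and every zero has
multiplicity `≥ 1`). [folklore] -/
theorem quadrant_finite_and_ncard_le (θ T : ℝ) {σ : ℝ} (hσ : σ ≤ 1 / 2 + θ) :
    {ρ ∈ {ρ : ℂ | ρ ∈ riemannZetaNontrivialZeros ∧ 1 / 2 + θ ≤ ρ.re ∧ 0 < ρ.im} | ρ.im ≤ T}.Finite ∧
      (({ρ ∈ {ρ : ℂ | ρ ∈ riemannZetaNontrivialZeros ∧ 1 / 2 + θ ≤ ρ.re ∧ 0 < ρ.im} |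
          ρ.im ≤ T}.ncard : ℕ) : ℝ) ≤ (zetaZeroCountRe σ T : ℝ) := by
  have hB := zetaZeroBox_finite σ T
  have hsub : {ρ ∈ {ρ : ℂ | ρ ∈ riemannZetaNontrivialZeros ∧ 1 / 2 + θ ≤ ρ.re ∧ 0 < ρ.im} |
      ρ.im ≤ T} ⊆ zetaZeroBox σ T := by
    rintro ρ ⟨⟨hz, hre, him⟩, hT⟩
    exact ⟨riemannZetaNontrivialZeros.zeta_eq_zero hz, hσ.trans hre,
      (riemannZetaNontrivialZeros.re_lt_one hz).le, him, hT⟩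
  refine ⟨hB.subset hsub, ?_⟩
  rw [natCast_zetaZeroCountRe]
  calc (({ρ ∈ {ρ : ℂ | ρ ∈ riemannZetaNontrivialZeros ∧ 1 / 2 + θ ≤ ρ.re ∧ 0 < ρ.im} |
          ρ.im ≤ T}.ncard : ℕ) : ℝ)
      ≤ ((zetaZeroBox σ T).ncard : ℝ) := by exact_mod_cast ncard_le_ncard hsub hB
    _ = ∑ _ρ ∈ hB.toFinset, (1 : ℝ) := by
        rw [ncard_eq_toFinset_card _ hB, Finset.sum_const, nsmul_eq_mul, mul_one]
    _ ≤ ∑ ρ ∈ hB.toFinset, (riemannZetaZeroOrder ρ : ℝ) := by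
        refine Finset.sum_le_sum fun ρ hρ ↦ ?_
        have hmem : ρ ∈ riemannZetaNontrivialZeros :=
          zetaZeroBox_subset_riemannZetaNontrivialZeros σ T ((Finite.mem_toFinset hB).1 hρ)
        exact_mod_cast riemannZetaNontrivialZeros.one_le_order hmem

/-- The quadrant count is monotone in the height `T` (PROVED). [folklore] -/
theorem quadrant_ncard_mono (θ : ℝ) {T T' : ℝ} (hTT' : T ≤ T') :
    ({ρ ∈ {ρ : ℂ | ρ ∈ riemannZetaNontrivialZeros ∧ 1 / 2 + θ ≤ ρ.re ∧ 0 < ρ.im} | ρ.im ≤ T}.ncard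
        : ℕ) ≤
      {ρ ∈ {ρ : ℂ | ρ ∈ riemannZetaNontrivialZeros ∧ 1 / 2 + θ ≤ ρ.re ∧ 0 < ρ.im} |
          ρ.im ≤ T'}.ncard :=
  ncard_le_ncard (fun _ hρ ↦ ⟨hρ.1, hρ.2.trans hTT'⟩)
    (quadrant_finite_and_ncard_le θ T' le_rfl).1

/-! ## 3. One zero-density estimate with exponent `< 1` gives the counting shape -/

/-- **Zero-density estimate ⇒ counting shape (PROVED, RH-free).**  If `N(σ', T) ≪_ε T^{A(σ')(1−σ')+ε}`
on `σ₀ ≤ σ' ≤ 1` (`ZeroDensityEstimate A σ₀`) and at some abscissa `σ ∈ [σ₀, 1]` with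
`σ ≤ 1/2 + θ` the exponent satisfies `A(σ)(1−σ) < 1`, then `QuadrantCountingPowerBound θ` holds:
choose `ε` with `e := A(σ)(1−σ) + ε ∈ [1/2, 1)`, get `N(σ, T) ≤ c·T^e` for `T ≥ T₀`, and make it
uniform on `T ≥ 1` with the constant `c·T₁^e`, `T₁ = max T₀ 1`, by monotonicity in `T`. [folklore] -/
theorem quadrantCountingPowerBound_of_zeroDensityEstimate {A : ℝ → ℝ} {σ₀ σ θ : ℝ}
    (h : ZeroDensityEstimate A σ₀) (h₀ : σ₀ ≤ σ) (h₁ : σ ≤ 1) (hσθ : σ ≤ 1 / 2 + θ)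
    (hA : A σ * (1 - σ) < 1) : QuadrantCountingPowerBound θ := by
  obtain ⟨e, hea, he1, he0⟩ : ∃ e : ℝ, A σ * (1 - σ) < e ∧ e < 1 ∧ 0 ≤ e :=
    ⟨max (1 / 2) ((1 + A σ * (1 - σ)) / 2), lt_max_of_lt_right (by linarith),
      max_lt (by norm_num) (by linarith), le_trans (by norm_num) (le_max_left _ _)⟩
  have hO := h (e - A σ * (1 - σ)) (by linarith) σ h₀ h₁
  have hexp : A σ * (1 - σ) + (e - A σ * (1 - σ)) = e := by ring
  rw [hexp] at hO
  obtain ⟨c, hc0, hc⟩ := hO.exists_nonneg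
  obtain ⟨T₀, hT₀⟩ := Filter.eventually_atTop.1 hc.bound
  set T₁ : ℝ := max T₀ 1 with hT₁
  have hT₁1 : 1 ≤ T₁ := le_max_right _ _
  have hT₁e : 1 ≤ T₁ ^ e := Real.one_le_rpow hT₁1 he0
  -- the bound at heights `T ≥ T₁`
  have hbig : ∀ T : ℝ, T₁ ≤ T → (zetaZeroCountRe σ T : ℝ) ≤ c * T ^ e := by
    intro T hT
    have hb := hT₀ T ((le_max_left _ _).trans hT)
    rwa [Real.norm_of_nonneg (Nat.cast_nonneg _),
      Real.norm_of_nonneg (Real.rpow_nonneg (by linarith) _)] at hb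
  refine ⟨e, he1, c * T₁ ^ e, fun T hT ↦ ?_⟩
  obtain ⟨hfin, hle⟩ := quadrant_finite_and_ncard_le θ T hσθ
  refine ⟨hfin, ?_⟩
  have hTe : 1 ≤ T ^ e := Real.one_le_rpow hT he0
  have hTe0 : 0 ≤ T ^ e := Real.rpow_nonneg (by linarith) _
  rcases le_or_gt T₁ T with hT₁T | hTT₁
  · calc (({ρ ∈ {ρ : ℂ | ρ ∈ riemannZetaNontrivialZeros ∧ 1 / 2 + θ ≤ ρ.re ∧ 0 < ρ.im} |
            ρ.im ≤ T}.ncard : ℕ) : ℝ)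
        ≤ (zetaZeroCountRe σ T : ℝ) := hle
      _ ≤ c * T ^ e := hbig T hT₁T
      _ = c * 1 * T ^ e := by rw [mul_one]
      _ ≤ c * T₁ ^ e * T ^ e := by gcongr
  · obtain ⟨-, hle₁⟩ := quadrant_finite_and_ncard_le θ T₁ hσθ
    calc (({ρ ∈ {ρ : ℂ | ρ ∈ riemannZetaNontrivialZeros ∧ 1 / 2 + θ ≤ ρ.re ∧ 0 < ρ.im} |
            ρ.im ≤ T}.ncard : ℕ) : ℝ)
        ≤ (({ρ ∈ {ρ : ℂ | ρ ∈ riemannZetaNontrivialZeros ∧ 1 / 2 + θ ≤ ρ.re ∧ 0 < ρ.im} |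
            ρ.im ≤ T₁}.ncard : ℕ) : ℝ) := by exact_mod_cast quadrant_ncard_mono θ hTT₁.le
      _ ≤ (zetaZeroCountRe σ T₁ : ℝ) := hle₁
      _ ≤ c * T₁ ^ e := hbig T₁ le_rfl
      _ = c * T₁ ^ e * 1 := by rw [mul_one]
      _ ≤ c * T₁ ^ e * T ^ e := by gcongr

/-- **An estimate on `[1/2, 1]` with exponent `< 1` off the line gives the shape for every `θ > 0`
(PROVED, RH-free).**  (For `1/2 + θ > 1` the quadrant is empty and the abscissa `σ = 1` is used.)
[folklore] -/
theorem quadrantCountingPowerBound_of_zeroDensityEstimate_half {A : ℝ → ℝ}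
    (h : ZeroDensityEstimate A (1 / 2)) (hA : ∀ σ : ℝ, 1 / 2 < σ → σ ≤ 1 → A σ * (1 - σ) < 1)
    {θ : ℝ} (hθ : 0 < θ) : QuadrantCountingPowerBound θ := by
  by_cases hθ1 : 1 / 2 + θ ≤ 1
  · exact quadrantCountingPowerBound_of_zeroDensityEstimate h (by linarith) hθ1 le_rfl
      (hA _ (by linarith) hθ1)
  · exact quadrantCountingPowerBound_of_zeroDensityEstimate (σ := 1) h (by norm_num) le_rfl
      (by linarith) (by norm_num)

/-! ## 4. Ingham's theorem (the tree's named fact) gives `(SUM_θ)` for every `θ > 0` -/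

/-- Ingham's exponent is `< 1` off the critical line: `3(1−σ)/(2−σ) < 1 ⟺ σ > 1/2` (for `σ < 2`).
[folklore] -/
theorem ingham_exponent_mul_lt_one {σ : ℝ} (h₀ : 1 / 2 < σ) (h₁ : σ ≤ 1) :
    3 / (2 - σ) * (1 - σ) < 1 := by
  rw [div_mul_eq_mul_div, div_lt_one (by linarith)]
  linarith

/-- **Ingham 1940 ⇒ the counting shape for every `θ > 0` (PROVED modulo the NAMED FACT
`zeroDensity_ingham`, Titchmarsh Thm 9.19 (B); RH-free).** [folklore] -/
theorem quadrantCountingPowerBound_of_ingham (h : zeroDensity_ingham) {θ : ℝ} (hθ : 0 < θ) :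
    QuadrantCountingPowerBound θ :=
  quadrantCountingPowerBound_of_zeroDensityEstimate_half h
    (fun _ h₀ h₁ ↦ ingham_exponent_mul_lt_one h₀ h₁) hθ

/-- For comparison only: the density hypothesis (`A ≡ 2` on `[1/2, 1]`, an OPEN CONJECTURE in the
tree) also gives the shape, since `2(1−σ) < 1 ⟺ σ > 1/2`; it is not needed below. [folklore] -/
theorem quadrantCountingPowerBound_of_densityHypothesis (h : DensityHypothesis) {θ : ℝ}
    (hθ : 0 < θ) : QuadrantCountingPowerBound θ :=
  quadrantCountingPowerBound_of_zeroDensityEstimate_half h (fun σ h₀ _ ↦ by linarith) hθ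

/-- **Ingham ⇒ `(SUM_θ)` (PROVED modulo the named fact): `∑_{ρ ∈ 𝒵_θ} 1/Im ρ < ∞` for every
`θ > 0`.** [folklore] -/
theorem summable_inv_im_quadrant_of_ingham (h : zeroDensity_ingham) {θ : ℝ} (hθ : 0 < θ) :
    Summable fun ρ : ↥{ρ : ℂ | ρ ∈ riemannZetaNontrivialZeros ∧ 1 / 2 + θ ≤ ρ.re ∧ 0 < ρ.im} ↦
      1 / (ρ : ℂ).im :=
  summable_inv_im_quadrant_of_counting (quadrantCountingPowerBound_of_ingham h hθ)

end Summit.RiemannHypothesis.RiemannHypothesis.Theorems.PfPersistenceM2NegIndex
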